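import Mathlib.Data.ZMod.Basic
import Mathlib.Data.Fintype.BigOperators
import Mathlib.Data.Finset.Powerset
import Mathlib.Algebra.BigOperators.Ring.Finset
import Mathlib.Data.Nat.Choose.Sum
import Mathlib.Tactic
import HarnessLib

/-!
# Subcubes over the `d`-subsets of a coordinate set of `𝔽₂ⁿ` and the layer `{wt_A = d}`: exact counts

Elementary combinatorics of the cube `V n = Fin n → ZMod 2` (used by the Summits-side refutation of
the Alekseev–Gaevoy union-stability statement for affine subspaces, ECCC TR26-007 §1.2 (1.4); see
`CubeMiddleLayerInstance.lean`). Fix a coordinate set `A ⊆ Fin n`, `|A| = a`, and a layer index `d`: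

* members `Φ_S = {x : x_j = 1 for all j ∈ S}`, `S ∈ (A choose d)` — coordinate subcubes of codimension `d`
  (`Phi`; `card_Phi : |Φ_S| = 2^{n-|S|}`);
* the layer `B = {x : wt_A(x) = d}` (`Bset`; `card_Bset : |B| = C(a,d)·2^{n-a}`);
* the survivors `Φ'_S = Φ_S ∖ B` (`PhiP`); the unions `U = ⋃_S Φ_S = {x : wt_A(x) ≥ d}` (`Uset`, `mem_Uset`,
  `card_Uset : |U| = (Σ_{w=d}^{a} C(a,w))·2^{n-a}`) and `U' = ⋃_S Φ'_S = U ∖ B` (`U'set`, `U'set_eq_sdiff`,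
  `card_U'set_add_card_Bset`).

All statements are cardinal identities, cleared of denominators; counting is transported to
`Finset (Fin n)` along the support bijection (`card_filter_supp`). Continued in `CubeMiddleLayerLoss.lean`
(each member meets `B` in exactly a `2^{-k}` fraction, `a = d + k`; affine structure),
`CubeMiddleLayerBounds.lean` (`|U| ≥ 2^{n-1}` for `d ≤ k`; `|U| ≤ 2√k·|B|` for `d = k`) and
`CubeMiddleLayerInstance.lean` (the assembled family with thresholds in `n`).

-- adapted from reserve/prior-2001/Prior/PneNP/PneNP/Pnp_Y3DaglikeReslinWidthAndLayerCounting_MiddleLayerCounterexample.lean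
-- (internal 2001 programme, route y3, manuscript "The middle layer of the cube refutes a union-stability
-- conjecture for affine subspaces", v2 6c855445, 2026-08; unpublished, NOT cited as a source anywhere in
-- the tree); proofs unchanged, namespace and docstrings adapted.
-/

namespace Literature.Combinatorics.SetFamily

open Finset

namespace CubeMiddleLayer

/-- The ambient space 𝔽₂ⁿ. [folklore] -/
abbrev V (n : ℕ) : Type := Fin n → ZMod 2

variable {n : ℕ}

/-! ### The support bijection with `Finset (Fin n)` -/

/-- The support of a vector: the set of coordinates equal to 1. [folklore] -/
def supp (x : V n) : Finset (Fin n) := Finset.univ.filter (fun i => x i = 1)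

/-- The indicator vector of a coordinate set. [folklore] -/
def ind (S : Finset (Fin n)) : V n := fun i => if i ∈ S then 1 else 0

/-- Every element of `ZMod 2` is `0` or `1`. [folklore] -/
lemma zmod2_cases (a : ZMod 2) : a = 0 ∨ a = 1 := by revert a; decide

/-- Membership in the support: `i ∈ supp x ↔ x i = 1`. [folklore] -/
@[simp] lemma mem_supp {x : V n} {i : Fin n} : i ∈ supp x ↔ x i = 1 := by
  simp [supp]

/-- `ind (supp x) = x`: indicator and support are inverse bijections (first half). [folklore] -/
@[simp] lemma ind_supp (x : V n) : ind (supp x) = x := by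
  funext i
  rcases zmod2_cases (x i) with h | h <;> simp [ind, h]

/-- `supp (ind S) = S`: indicator and support are inverse bijections (second half). [folklore] -/
@[simp] lemma supp_ind (S : Finset (Fin n)) : supp (ind S) = S := by
  ext i
  by_cases h : i ∈ S <;> simp [ind, h]

/-- Transport of counting along the support bijection. [folklore] -/
lemma card_filter_supp (p : Finset (Fin n) → Prop) [DecidablePred p] :
    (Finset.univ.filter (fun x : V n => p (supp x))).card
      = (Finset.univ.filter p).card := by
  apply Finset.card_bij' (i := fun x _ => supp x) (j := fun S _ => ind S)
  · intro x hx
    simpa using (Finset.mem_filter.mp hx).2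
  · intro S hS
    simpa using (Finset.mem_filter.mp hS).2
  · intro x _
    exact ind_supp x
  · intro S _
    exact supp_ind S

/-! ### The family: subcubes over the `d`-subsets of a coordinate set `A`,
with the middle layer `B = {x : wt_A(x) = d}` removed from every member. -/

/-- Weight of `x` on the coordinate set `A`. [folklore] -/
def wtOn (A : Finset (Fin n)) (x : V n) : ℕ := (A.filter (fun i => x i = 1)).card

/-- `Φ_S = {x : x_S = 1}` — the coordinate subcube prescribing 1 on `S`. [folklore] -/
def Phi (S : Finset (Fin n)) : Finset (V n) :=
  Finset.univ.filter (fun x => ∀ j ∈ S, x j = 1)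

/-- `B = {x : wt_A(x) = d}` — the removed layer. [folklore] -/
def Bset (A : Finset (Fin n)) (d : ℕ) : Finset (V n) :=
  Finset.univ.filter (fun x => wtOn A x = d)

/-- `Φ'_S = Φ_S \ B` — the surviving part of the member. [folklore] -/
def PhiP (A : Finset (Fin n)) (d : ℕ) (S : Finset (Fin n)) : Finset (V n) :=
  Phi S \ Bset A d

/-- `U = ⋃ {Φ_S : S ⊆ A, |S| = d}`. [folklore] -/
def Uset (A : Finset (Fin n)) (d : ℕ) : Finset (V n) :=
  (Finset.powersetCard d A).biUnion Phi

/-- `U' = ⋃ {Φ'_S : S ⊆ A, |S| = d}`. [folklore] -/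
def U'set (A : Finset (Fin n)) (d : ℕ) : Finset (V n) :=
  (Finset.powersetCard d A).biUnion (PhiP A d)

/-- The weight of `x` on `A` is `|A ∩ supp x|`. [folklore] -/
lemma wtOn_eq_card_inter (A : Finset (Fin n)) (x : V n) :
    wtOn A x = (A ∩ supp x).card := by
  unfold wtOn
  congr 1
  ext i
  simp [supp, Finset.mem_filter, Finset.mem_inter]

/-- Membership in the subcube: `x ∈ Φ_S ↔ S ⊆ supp x`. [folklore] -/
lemma mem_Phi {S : Finset (Fin n)} {x : V n} : x ∈ Phi S ↔ S ⊆ supp x := by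
  simp [Phi, Finset.subset_iff]

/-- Membership in the removed layer: `x ∈ B ↔ wt_A(x) = d`. [folklore] -/
lemma mem_Bset {A : Finset (Fin n)} {d : ℕ} {x : V n} :
    x ∈ Bset A d ↔ wtOn A x = d := by
  simp [Bset]

/-- Membership in the union `U = ⋃_{S ∈ (A choose d)} Φ_S`: `x ∈ U ↔ wt_A(x) ≥ d`. [folklore] -/
lemma mem_Uset {A : Finset (Fin n)} {d : ℕ} {x : V n} :
    x ∈ Uset A d ↔ d ≤ wtOn A x := by
  constructor
  · rintro hx
    obtain ⟨S, hS, hxS⟩ := Finset.mem_biUnion.mp hx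
    obtain ⟨hSA, hScard⟩ := Finset.mem_powersetCard.mp hS
    have hSsub : S ⊆ A ∩ supp x := Finset.subset_inter hSA (mem_Phi.mp hxS)
    calc d = S.card := hScard.symm
    _ ≤ (A ∩ supp x).card := Finset.card_le_card hSsub
    _ = wtOn A x := (wtOn_eq_card_inter A x).symm
  · intro hx
    rw [wtOn_eq_card_inter] at hx
    obtain ⟨S, hSsub, hScard⟩ := Finset.exists_subset_card_eq hx
    refine Finset.mem_biUnion.mpr ⟨S, Finset.mem_powersetCard.mpr
      ⟨hSsub.trans Finset.inter_subset_left, hScard⟩, mem_Phi.mpr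
      (hSsub.trans Finset.inter_subset_right)⟩

/-- The removed layer lies inside the union: `B ⊆ U`. [folklore] -/
lemma Bset_subset_Uset (A : Finset (Fin n)) (d : ℕ) : Bset A d ⊆ Uset A d := by
  intro x hx
  rw [mem_Bset] at hx
  rw [mem_Uset]
  omega

/-- `⋃ Φ'_S = U \ B`: the removed set is common to all members, so the union of the
survivors is exactly the union minus `B`. [folklore] -/
lemma U'set_eq_sdiff (A : Finset (Fin n)) (d : ℕ) :
    U'set A d = Uset A d \ Bset A d := by
  ext x
  simp only [U'set, PhiP, Uset, Finset.mem_biUnion, Finset.mem_sdiff]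
  constructor
  · rintro ⟨S, hS, hxPhi, hxB⟩
    exact ⟨⟨S, hS, hxPhi⟩, hxB⟩
  · rintro ⟨⟨S, hS, hxPhi⟩, hxB⟩
    exact ⟨S, hS, hxPhi, hxB⟩

/-- The union of the survivors lies inside the union: `U' ⊆ U`. [folklore] -/
lemma U'set_subset_Uset (A : Finset (Fin n)) (d : ℕ) : U'set A d ⊆ Uset A d := by
  rw [U'set_eq_sdiff]
  exact Finset.sdiff_subset

/-- `|U'| + |B| = |U|` (with `B ⊆ U`). [folklore] -/
lemma card_U'set_add_card_Bset (A : Finset (Fin n)) (d : ℕ) :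
    (U'set A d).card + (Bset A d).card = (Uset A d).card := by
  rw [U'set_eq_sdiff]
  exact Finset.card_sdiff_add_card_eq_card (Bset_subset_Uset A d)

/-! ### Counting in `Finset (Fin n)` -/

/-- The number of supersets of `S` is `2^(n - |S|)`. [folklore] -/
lemma card_filter_subset_eq (S : Finset (Fin n)) :
    (Finset.univ.filter (fun X : Finset (Fin n) => S ⊆ X)).card = 2 ^ (n - S.card) := by
  have htarget : (Finset.univ \ S).powerset.card = 2 ^ (n - S.card) := by
    rw [Finset.card_powerset, Finset.card_sdiff_of_subset (Finset.subset_univ S),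
      Finset.card_univ, Fintype.card_fin]
  rw [← htarget]
  apply Finset.card_bij' (i := fun X _ => X \ S) (j := fun P _ => P ∪ S)
  · intro X hX
    exact Finset.mem_powerset.mpr (Finset.sdiff_subset_sdiff (Finset.subset_univ X) le_rfl)
  · intro P _
    exact Finset.mem_filter.mpr ⟨Finset.mem_univ _, Finset.subset_union_right⟩
  · intro X hX
    exact Finset.sdiff_union_of_subset (Finset.mem_filter.mp hX).2
  · intro P hP
    have hPS : ∀ i ∈ P, i ∉ S := by
      intro i hi
      exact (Finset.mem_sdiff.mp ((Finset.mem_powerset.mp hP) hi)).2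
    ext i
    simp only [Finset.mem_sdiff, Finset.mem_union]
    constructor
    · rintro ⟨hiP | hiS, hiS'⟩
      · exact hiP
      · exact absurd hiS hiS'
    · intro hiP
      exact ⟨Or.inl hiP, hPS i hiP⟩

/-- The number of `X` with `|A ∩ X| = w` is `C(|A|, w) · 2^(n - |A|)`. [folklore] -/
lemma card_filter_inter_card_eq (A : Finset (Fin n)) (w : ℕ) :
    (Finset.univ.filter (fun X : Finset (Fin n) => (A ∩ X).card = w)).card
      = A.card.choose w * 2 ^ (n - A.card) := by
  have htarget : ((Finset.powersetCard w A) ×ˢ (Finset.univ \ A).powerset).card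
      = A.card.choose w * 2 ^ (n - A.card) := by
    rw [Finset.card_product, Finset.card_powersetCard, Finset.card_powerset,
      Finset.card_sdiff_of_subset (Finset.subset_univ A), Finset.card_univ, Fintype.card_fin]
  rw [← htarget]
  apply Finset.card_bij' (i := fun X _ => (A ∩ X, X \ A)) (j := fun P _ => P.1 ∪ P.2)
  · intro X hX
    refine Finset.mem_product.mpr ⟨Finset.mem_powersetCard.mpr
      ⟨Finset.inter_subset_left, (Finset.mem_filter.mp hX).2⟩,
      Finset.mem_powerset.mpr (Finset.sdiff_subset_sdiff (Finset.subset_univ X) le_rfl)⟩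
  · intro P hP
    obtain ⟨hP1, hP2⟩ := Finset.mem_product.mp hP
    obtain ⟨hPA, hPcard⟩ := Finset.mem_powersetCard.mp hP1
    have hP2A : ∀ i ∈ P.2, i ∉ A := fun i hi =>
      (Finset.mem_sdiff.mp ((Finset.mem_powerset.mp hP2) hi)).2
    refine Finset.mem_filter.mpr ⟨Finset.mem_univ _, ?_⟩
    have : A ∩ (P.1 ∪ P.2) = P.1 := by
      ext i
      simp only [Finset.mem_inter, Finset.mem_union]
      constructor
      · rintro ⟨hiA, hiP1 | hiP2⟩
        · exact hiP1
        · exact absurd hiA (hP2A i hiP2)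
      · intro hi
        exact ⟨hPA hi, Or.inl hi⟩
    rw [this, hPcard]
  · intro X _
    ext i
    simp only [Finset.mem_union, Finset.mem_inter, Finset.mem_sdiff]
    constructor
    · rintro (⟨_, hiX⟩ | ⟨hiX, _⟩) <;> exact hiX
    · intro hiX
      by_cases hiA : i ∈ A
      · exact Or.inl ⟨hiA, hiX⟩
      · exact Or.inr ⟨hiX, hiA⟩
  · intro P hP
    obtain ⟨hP1, hP2⟩ := Finset.mem_product.mp hP
    have hPA : P.1 ⊆ A := (Finset.mem_powersetCard.mp hP1).1
    have hP2A : ∀ i ∈ P.2, i ∉ A := fun i hi =>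
      (Finset.mem_sdiff.mp ((Finset.mem_powerset.mp hP2) hi)).2
    have e1 : A ∩ (P.1 ∪ P.2) = P.1 := by
      ext i
      simp only [Finset.mem_inter, Finset.mem_union]
      constructor
      · rintro ⟨hiA, hiP1 | hiP2⟩
        · exact hiP1
        · exact absurd hiA (hP2A i hiP2)
      · intro hi
        exact ⟨hPA hi, Or.inl hi⟩
    have e2 : (P.1 ∪ P.2) \ A = P.2 := by
      ext i
      simp only [Finset.mem_sdiff, Finset.mem_union]
      constructor
      · rintro ⟨hiP1 | hiP2, hiA⟩
        · exact absurd (hPA hiP1) hiA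
        · exact hiP2
      · intro hi
        exact ⟨Or.inr hi, hP2A i hi⟩
    exact Prod.ext e1 e2

/-- Counting `X` by a predicate on `|A ∩ X|`, fiberwise over the weight. [folklore] -/
lemma card_filter_wt (A : Finset (Fin n)) (P : ℕ → Prop) [DecidablePred P] :
    (Finset.univ.filter (fun X : Finset (Fin n) => P ((A ∩ X).card))).card
      = ∑ w ∈ (Finset.range (A.card + 1)).filter P,
          A.card.choose w * 2 ^ (n - A.card) := by
  rw [Finset.card_eq_sum_card_fiberwise
    (f := fun X : Finset (Fin n) => (A ∩ X).card)
    (t := (Finset.range (A.card + 1)).filter P) ?_]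
  · refine Finset.sum_congr rfl (fun w hw => ?_)
    have hPw : P w := (Finset.mem_filter.mp hw).2
    rw [Finset.filter_filter]
    have hcong : Finset.univ.filter
          (fun X : Finset (Fin n) => P ((A ∩ X).card) ∧ (A ∩ X).card = w)
        = Finset.univ.filter (fun X : Finset (Fin n) => (A ∩ X).card = w) := by
      apply Finset.filter_congr
      intro X _
      constructor
      · exact fun h => h.2
      · exact fun h => ⟨h ▸ hPw, h⟩
    rw [hcong, card_filter_inter_card_eq]
  · intro X hX
    refine Finset.mem_filter.mpr ⟨Finset.mem_range.mpr ?_, (Finset.mem_filter.mp hX).2⟩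
    exact Nat.lt_succ_of_le (Finset.card_le_card Finset.inter_subset_left)

/-! ### Exact cardinalities -/

/-- A coordinate set has at most `n` elements. [folklore] -/
lemma card_le_univ_n (A : Finset (Fin n)) : A.card ≤ n := by
  calc A.card ≤ (Finset.univ : Finset (Fin n)).card := Finset.card_le_univ A
  _ = n := by rw [Finset.card_univ, Fintype.card_fin]

/-- `|𝔽₂ⁿ| = 2^n`. [folklore] -/
lemma card_univ_V : (Finset.univ : Finset (V n)).card = 2 ^ n := by
  rw [Finset.card_univ, Fintype.card_fun, ZMod.card 2, Fintype.card_fin]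

/-- `|Φ_S| = 2^(n - |S|)`: the subcube has codimension `|S|`, in cardinality form. [folklore] -/
theorem card_Phi (S : Finset (Fin n)) : (Phi S).card = 2 ^ (n - S.card) := by
  have e : Phi S = Finset.univ.filter (fun x : V n => S ⊆ supp x) := by
    ext x
    simp [mem_Phi]
  rw [e, show (Finset.univ.filter (fun x : V n => S ⊆ supp x)).card
      = (Finset.univ.filter (fun X : Finset (Fin n) => S ⊆ X)).card from
    card_filter_supp (fun X => S ⊆ X)]
  exact card_filter_subset_eq S

/-- `|B| = C(|A|, d) · 2^(n - |A|)`: the removed layer is one binomial layer. [folklore] -/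
theorem card_Bset (A : Finset (Fin n)) (d : ℕ) :
    (Bset A d).card = A.card.choose d * 2 ^ (n - A.card) := by
  have e : Bset A d = Finset.univ.filter (fun x : V n => (A ∩ supp x).card = d) := by
    ext x
    simp [mem_Bset, wtOn_eq_card_inter]
  rw [e, show (Finset.univ.filter (fun x : V n => (A ∩ supp x).card = d)).card
      = (Finset.univ.filter (fun X : Finset (Fin n) => (A ∩ X).card = d)).card from
    card_filter_supp (fun X => (A ∩ X).card = d)]
  exact card_filter_inter_card_eq A d

/-- `{w ≤ a : d ≤ w} = [d, a]` as finsets of naturals. [folklore] -/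
lemma filter_range_le (d a : ℕ) :
    (Finset.range (a + 1)).filter (fun w => d ≤ w) = Finset.Icc d a := by
  ext w
  simp only [Finset.mem_filter, Finset.mem_range, Finset.mem_Icc]
  omega

/-- `|U| = (Σ_{d ≤ w ≤ |A|} C(|A|, w)) · 2^(n - |A|)`. [folklore] -/
theorem card_Uset (A : Finset (Fin n)) (d : ℕ) :
    (Uset A d).card = (∑ w ∈ Finset.Icc d A.card, A.card.choose w) * 2 ^ (n - A.card) := by
  have e : Uset A d = Finset.univ.filter (fun x : V n => d ≤ (A ∩ supp x).card) := by
    ext x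
    simp [mem_Uset, wtOn_eq_card_inter]
  rw [e, show (Finset.univ.filter (fun x : V n => d ≤ (A ∩ supp x).card)).card
      = (Finset.univ.filter (fun X : Finset (Fin n) => d ≤ (A ∩ X).card)).card from
    card_filter_supp (fun X => d ≤ (A ∩ X).card),
    show (Finset.univ.filter (fun X : Finset (Fin n) => d ≤ (A ∩ X).card)).card
      = ∑ w ∈ (Finset.range (A.card + 1)).filter (fun w => d ≤ w),
          A.card.choose w * 2 ^ (n - A.card) from card_filter_wt A (fun w => d ≤ w),
    filter_range_le, ← Finset.sum_mul]

end CubeMiddleLayer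

end Literature.Combinatorics.SetFamily
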